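import Summits.CriticalPhenomena.PercolationContinuityZ3.Theses.PercBurnResprinkle
import Literature.Probability.Percolation.PercolationProofs
import Literature.Probability.Percolation.StaticRenormalizationBlocks
import Literature.Probability.Percolation.BondPercolationSymmetry
import Literature.Probability.LatticeModels.StarBoundary
import HarnessLib
import Literature.Probability.Percolation.DependentStarPercolation
import Summits.CriticalPhenomena.PercolationContinuityZ3.Theorems.PercBurnResprinkleVacantReignitionFreshDominationAux
import Summits.CriticalPhenomena.PercolationContinuityZ3.Theorems.PercBurnResprinkleVacantReignitionCoarsePercolationAux

/-!
# Crux `PercBurnResprinkle.VacantReignition` (stmt-CriticalPhenomena-7203), line `holes-are-fresh` — stub `stub_coarsePercolation`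

(worker of lead prover-line-stmt-CriticalPhenomena-7203-c1-0; registered stub of the skeleton
`Cruxes/VacantReignition/Lines/holes_are_fresh.lean`, statement DEF-FREE over tree vocabulary.)

**What is proved.** The COARSE PERCOLATION step of the separated ADKS renormalisation
(Ahlberg–Duminil-Copin–Kozma–Sidoravicius 2015, §2) at `d = 3`: there is an absolute constant
`η₁ > 0` (we take `η₁ = δ^100 / 2`, `δ = 1 / (204 · 200^100)`) such that for aspect `k ≥ 1`, coarse
spacing `S ≥ k + 5`, clump bound `D`, block scale `L ≥ 1` and levels `p, q`: if for every coarse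
planar site `x ∈ ℤ²` the ENVIRONMENT event `¬HARMLESS_p(x)` and the FRESH-field event `BLOCKED_q(x)`
each have `labelMeasure`-probability `≤ η₁`, then under the product `labelMeasure ⊗ labelMeasure` of
the two label fields, with probability `≥ 1/2` the coarse site `0` is OPENP
(`HARMLESS_p(0)(π.1) ∧ ¬BLOCKED_q(0)(π.2)`) and the `★`-cluster of `0` in the set of OPENP sites is
infinite.

**Proof.** The tree's finitely dependent planar `★`-Peierls criterion
`le_measureReal_infinite_starCluster_of_good` (`DependentStarPercolation.lean`; Grimmett 1999,
§7.4 and §8.6) with `d = 2`, range `r = 9` and `δ = 1/(204 · 200^100)` (so that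
`2 (10² + 2) (2 · 10²)^100 δ = 1`) reduces the claim to the sparse product bound
`μ⊗μ (⋂_{b ∈ T} OPENP(b)ᶜ) ≤ δ^{100 #T}` for finite `T ⊆ ℤ²` with pairwise sup-distance `> 9`.
Since `OPENP(b)ᶜ ⊆ {¬HARMLESS(b)(π.1)} ∪ {BLOCKED(b)(π.2)}`, sorting the sites of `T` by which of
the two happens gives `⋂_T OPENP(b)ᶜ ⊆ ⋃_{T₁ ⊆ T} {∀ b ∈ T₁, ¬HARMLESS(b)} ×ˢ {∀ b ∈ T ∖ T₁, BLOCKED(b)}`,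
and `μ⊗μ` of a product set factorises (`Measure.prod_prod`;
`vacantReignition_cp_prod_real_biInter_compl_le`).  WITHIN each field the events at distinct sites
of `T` are independent with probability `≤ η₁` each (`vacantReignition_cp_real_biInter_le_pow`):
`¬HARMLESS(b)` and `BLOCKED(b)` are measurable and read only the labels of the pairs inside the
window `(2L+1)·(0, S b₀, S b₁) + B(4 S (2L+1))` — the TOUCHED / GOOD events of the blocks `ι z`,
`|zᵢ - S bᵢ| ≤ 3S`, are cylinder events of radius `≤ S(2L+1)` about `(2L+1) ι z`
(`determinedBy_boxArm`, `vacantReignition_dom_determinedBy_goodEvent`,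
`vacantReignition_dom_dependsOn_seen`; this uses `(2k+6)L + 3 ≤ S(2L+1)`, i.e. `k + 5 ≤ S`) —,
the windows of `9`-separated sites are disjoint (`10 S(2L+1) > 8 S(2L+1)`,
`vacantReignition_dom_disjoint_windows`), and disjointly supported events of the i.i.d. label field
are independent (`vacantReignition_dom_indep_generateFrom`).  Each summand is thus
`≤ η₁^{#T₁} η₁^{#T - #T₁}`, and the sum over `T₁` is `(2 η₁)^{#T} = δ^{100 #T}`.

Design: no definitions; the events are those spelled out in the registered signature, and the
measurability / locality / independence lemmas (auxiliary file
`PercBurnResprinkleVacantReignitionCoarsePercolationAux.lean`, names `vacantReignition_cp_*`) are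
stated for GENERIC predicates of the shape of `HARMLESS` and `BLOCKED` (functions of the families
`TOUCHED(ι z)`, `GOOD(ι z)`), so that the long events are written only in the statement and once
(the OPENP family handed to the Peierls criterion) in the proof.  Not here: the bounds `≤ η₁` themselves (neighbour
stubs `stub_levelShift`, `stub_blockedPeierls`) and the deterministic gluing (`stub_duality`,
`stub_coarseGlue`).

## References

* D. Ahlberg, H. Duminil-Copin, G. Kozma, V. Sidoravicius, *Seven-dimensional forest fires*,
  Ann. Inst. Henri Poincaré Probab. Stat. 51 (2015) 862–866, §2 [AhlbergEtAl2015].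
* G. Grimmett, *Percolation*, 2nd ed., Springer 1999, §7.4 pp. 178–189 and §8.6 pp. 222–223
  [GrimmettPercolation1999].
* T. M. Liggett, R. H. Schonmann, A. M. Stacey, *Domination by product measures*, Ann. Probab. 25
  (1997) 71–95, §0 [LiggettSchonmannStacey1997].
-/

noncomputable section

namespace Summit.CriticalPhenomena.PercolationContinuityZ3.Theorems

open MeasureTheory ProbabilityTheory Set
open Literature.Probability.Percolation Literature.Probability.LatticeModels

/-! ### The stub -/

/-- **Coarse percolation of the OPENP sites (ADKS planar renormalisation, separated architecture,
`d = 3`).** There is an absolute constant `η₁ > 0` such that for `k ≥ 1`, `k + 5 ≤ S`, `L ≥ 1`, any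
`D` and levels `p, q`: if every coarse site `x ∈ ℤ²` satisfies
`labelMeasure {U | ¬HARMLESS_p(x)(U)} ≤ η₁` (HARMLESS: every `★`-connected family of TOUCHED blocks
`ι z = (0, z₀, z₁)`, `|zᵢ - S xᵢ| ≤ 3S`, has index-diameter `≤ D`; TOUCHED: some window vertex of the
block has a level-`p` arm to sup-distance `S(2L+1)`) and `labelMeasure {U' | BLOCKED_q(x)(U')} ≤ η₁`
(BLOCKED: some `★`-connected `Γ` in the region, of extent `≥ S`, all of whose `★`-connected GOOD
sub-families have diameter `≤ D`), then with `labelMeasure ⊗ labelMeasure`-probability `≥ 1/2` the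
coarse site `0` is OPENP (`HARMLESS_p(0)(π.1) ∧ ¬BLOCKED_q(0)(π.2)`) and the `★`-cluster of `0` in
the OPENP sites is infinite.  This is the "good coarse boxes form a finitely dependent, highly
supercritical planar site process" step of Ahlberg–Duminil-Copin–Kozma–Sidoravicius (2015, §2), here
through the tree's dependent `★`-Peierls criterion with `r = 9`, `δ = 1/(204 · 200^100)`,
`η₁ = δ^100 / 2`. [cite: AhlbergEtAl2015, §2] -/
theorem stub_coarsePercolation :
    ∃ η₁ : ℝ, 0 < η₁ ∧ ∀ k : ℕ, 1 ≤ k → ∀ S D L : ℕ, k + 5 ≤ S → 1 ≤ L → ∀ p q : ℝ,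
      (∀ x : Fin 2 → ℤ, (labelMeasure (Fin 3 → ℤ)).real {U : (Sym2 (Fin 3 → ℤ) → ℝ) |
        ¬ (∀ A : Finset (Fin 2 → ℤ), (∀ z ∈ A, (∀ i, |z i - (S : ℤ) * x i| ≤ 3 * (S : ℤ)) ∧
        (∃ y ∈ (↑(box 3 (blockR L k)) : Set (Fin 3 → ℤ)),
          BondConfig.relabel (sym2Equiv (Site.shift (-(((2 * L + 1 : ℕ) : ℤ) • (![0, z 0, z 1] : Fin 3 → ℤ))))) (configOfLabels p U (zdGraph 3)) ∈ boxArm (S * (2 * L + 1)) y)) →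
        StarConn (↑A : Set (Fin 2 → ℤ)) → (∀ z ∈ A, ∀ z' ∈ A, ∀ i, |z i - z' i| ≤ (D : ℤ)))} ≤ η₁) →
      (∀ x : Fin 2 → ℤ, (labelMeasure (Fin 3 → ℤ)).real {U' : (Sym2 (Fin 3 → ℤ) → ℝ) |
        (∃ Γ : Finset (Fin 2 → ℤ), (∀ z ∈ Γ, (∀ i, |z i - (S : ℤ) * x i| ≤ 3 * (S : ℤ))) ∧ StarConn (↑Γ : Set (Fin 2 → ℤ)) ∧
        (∃ z ∈ Γ, ∃ z' ∈ Γ, ∃ i, (S : ℤ) ≤ |z i - z' i|) ∧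
        ∀ A : Finset (Fin 2 → ℤ), A ⊆ Γ → (∀ z ∈ A,
        ((∃ w ∈ (↑(box 3 L) : Set (Fin 3 → ℤ)),
          BondConfig.relabel (sym2Equiv (Site.shift (-(((2 * L + 1 : ℕ) : ℤ) • (![0, z 0, z 1] : Fin 3 → ℤ))))) (configOfLabels q U' (zdGraph 3)) ∈ boxArm (blockR L k + (2 * L + 1)) w) ∧
        ∀ u ∈ (↑(box 3 (3 * L + 1)) : Set (Fin 3 → ℤ)), ∀ v ∈ (↑(box 3 (3 * L + 1)) : Set (Fin 3 → ℤ)),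
          BondConfig.relabel (sym2Equiv (Site.shift (-(((2 * L + 1 : ℕ) : ℤ) • (![0, z 0, z 1] : Fin 3 → ℤ))))) (configOfLabels q U' (zdGraph 3)) ∉ twoArm (blockR L k) u v)) →
        StarConn (↑A : Set (Fin 2 → ℤ)) → (∀ z ∈ A, ∀ z' ∈ A, ∀ i, |z i - z' i| ≤ (D : ℤ)))} ≤ η₁) →
      1 / 2 ≤ ((labelMeasure (Fin 3 → ℤ)).prod (labelMeasure (Fin 3 → ℤ))).real {π : (Sym2 (Fin 3 → ℤ) → ℝ) × (Sym2 (Fin 3 → ℤ) → ℝ) |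
        ((∀ A : Finset (Fin 2 → ℤ), (∀ z ∈ A, (∀ i, |z i - (S : ℤ) * (0 : Fin 2 → ℤ) i| ≤ 3 * (S : ℤ)) ∧
        (∃ y ∈ (↑(box 3 (blockR L k)) : Set (Fin 3 → ℤ)),
          BondConfig.relabel (sym2Equiv (Site.shift (-(((2 * L + 1 : ℕ) : ℤ) • (![0, z 0, z 1] : Fin 3 → ℤ))))) (configOfLabels p π.1 (zdGraph 3)) ∈ boxArm (S * (2 * L + 1)) y)) →
        StarConn (↑A : Set (Fin 2 → ℤ)) → (∀ z ∈ A, ∀ z' ∈ A, ∀ i, |z i - z' i| ≤ (D : ℤ))) ∧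
        ¬ (∃ Γ : Finset (Fin 2 → ℤ), (∀ z ∈ Γ, (∀ i, |z i - (S : ℤ) * (0 : Fin 2 → ℤ) i| ≤ 3 * (S : ℤ))) ∧ StarConn (↑Γ : Set (Fin 2 → ℤ)) ∧
        (∃ z ∈ Γ, ∃ z' ∈ Γ, ∃ i, (S : ℤ) ≤ |z i - z' i|) ∧
        ∀ A : Finset (Fin 2 → ℤ), A ⊆ Γ → (∀ z ∈ A,
        ((∃ w ∈ (↑(box 3 L) : Set (Fin 3 → ℤ)),
          BondConfig.relabel (sym2Equiv (Site.shift (-(((2 * L + 1 : ℕ) : ℤ) • (![0, z 0, z 1] : Fin 3 → ℤ))))) (configOfLabels q π.2 (zdGraph 3)) ∈ boxArm (blockR L k + (2 * L + 1)) w) ∧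
        ∀ u ∈ (↑(box 3 (3 * L + 1)) : Set (Fin 3 → ℤ)), ∀ v ∈ (↑(box 3 (3 * L + 1)) : Set (Fin 3 → ℤ)),
          BondConfig.relabel (sym2Equiv (Site.shift (-(((2 * L + 1 : ℕ) : ℤ) • (![0, z 0, z 1] : Fin 3 → ℤ))))) (configOfLabels q π.2 (zdGraph 3)) ∉ twoArm (blockR L k) u v)) →
        StarConn (↑A : Set (Fin 2 → ℤ)) → (∀ z ∈ A, ∀ z' ∈ A, ∀ i, |z i - z' i| ≤ (D : ℤ)))) ∧
        {x : Fin 2 → ℤ | Relation.ReflTransGen (starRel {x' : Fin 2 → ℤ |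
        ((∀ A : Finset (Fin 2 → ℤ), (∀ z ∈ A, (∀ i, |z i - (S : ℤ) * x' i| ≤ 3 * (S : ℤ)) ∧
        (∃ y ∈ (↑(box 3 (blockR L k)) : Set (Fin 3 → ℤ)),
          BondConfig.relabel (sym2Equiv (Site.shift (-(((2 * L + 1 : ℕ) : ℤ) • (![0, z 0, z 1] : Fin 3 → ℤ))))) (configOfLabels p π.1 (zdGraph 3)) ∈ boxArm (S * (2 * L + 1)) y)) →
        StarConn (↑A : Set (Fin 2 → ℤ)) → (∀ z ∈ A, ∀ z' ∈ A, ∀ i, |z i - z' i| ≤ (D : ℤ))) ∧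
        ¬ (∃ Γ : Finset (Fin 2 → ℤ), (∀ z ∈ Γ, (∀ i, |z i - (S : ℤ) * x' i| ≤ 3 * (S : ℤ))) ∧ StarConn (↑Γ : Set (Fin 2 → ℤ)) ∧
        (∃ z ∈ Γ, ∃ z' ∈ Γ, ∃ i, (S : ℤ) ≤ |z i - z' i|) ∧
        ∀ A : Finset (Fin 2 → ℤ), A ⊆ Γ → (∀ z ∈ A,
        ((∃ w ∈ (↑(box 3 L) : Set (Fin 3 → ℤ)),
          BondConfig.relabel (sym2Equiv (Site.shift (-(((2 * L + 1 : ℕ) : ℤ) • (![0, z 0, z 1] : Fin 3 → ℤ))))) (configOfLabels q π.2 (zdGraph 3)) ∈ boxArm (blockR L k + (2 * L + 1)) w) ∧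
        ∀ u ∈ (↑(box 3 (3 * L + 1)) : Set (Fin 3 → ℤ)), ∀ v ∈ (↑(box 3 (3 * L + 1)) : Set (Fin 3 → ℤ)),
          BondConfig.relabel (sym2Equiv (Site.shift (-(((2 * L + 1 : ℕ) : ℤ) • (![0, z 0, z 1] : Fin 3 → ℤ))))) (configOfLabels q π.2 (zdGraph 3)) ∉ twoArm (blockR L k) u v)) →
        StarConn (↑A : Set (Fin 2 → ℤ)) → (∀ z ∈ A, ∀ z' ∈ A, ∀ i, |z i - z' i| ≤ (D : ℤ))))}) 0 x}.Infinite} := by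
  refine ⟨((1 : ℝ) / (204 * 200 ^ 100)) ^ 100 / 2, by positivity, ?_⟩
  intro k hk S D L hS hL p q hH hB
  have := isProbabilityMeasure_labelMeasure (Fin 3 → ℤ)
  set δ : ℝ := 1 / (204 * 200 ^ 100) with hδ
  have hδ0 : (0 : ℝ) ≤ δ := by rw [hδ]; positivity
  have hδ1 : 2 * ((9 + 1) ^ 2 + 2 : ℝ) * (2 * (3 ^ 2 + 1 : ℝ) ^ 2) ^ ((9 + 1) ^ 2) * δ ≤ 1 := by
    rw [hδ]; norm_num
  have hη0 : (0 : ℝ) ≤ δ ^ 100 / 2 := by positivity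
  have hS1 : 1 ≤ S := by omega
  have hN1 : 1 ≤ S * (2 * L + 1) := Nat.mul_pos (by omega) (by omega)
  have hfit : blockR L k + (2 * L + 1) ≤ S * (2 * L + 1) := by
    unfold blockR; nlinarith [Nat.mul_le_mul_right L hS]
  -- the finitely dependent planar `★`-Peierls criterion, `d = 2`, `r = 9`
  refine le_measureReal_infinite_starCluster_of_good (d := 2) (r := 9)
    (μ := (labelMeasure (Fin 3 → ℤ)).prod (labelMeasure (Fin 3 → ℤ))) le_rfl
    (fun x' : Fin 2 → ℤ => {π : (Sym2 (Fin 3 → ℤ) → ℝ) × (Sym2 (Fin 3 → ℤ) → ℝ) |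

        ((∀ A : Finset (Fin 2 → ℤ), (∀ z ∈ A, (∀ i, |z i - (S : ℤ) * x' i| ≤ 3 * (S : ℤ)) ∧
        (∃ y ∈ (↑(box 3 (blockR L k)) : Set (Fin 3 → ℤ)),
          BondConfig.relabel (sym2Equiv (Site.shift (-(((2 * L + 1 : ℕ) : ℤ) • (![0, z 0, z 1] : Fin 3 → ℤ))))) (configOfLabels p π.1 (zdGraph 3)) ∈ boxArm (S * (2 * L + 1)) y)) →
        StarConn (↑A : Set (Fin 2 → ℤ)) → (∀ z ∈ A, ∀ z' ∈ A, ∀ i, |z i - z' i| ≤ (D : ℤ))) ∧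
        ¬ (∃ Γ : Finset (Fin 2 → ℤ), (∀ z ∈ Γ, (∀ i, |z i - (S : ℤ) * x' i| ≤ 3 * (S : ℤ))) ∧ StarConn (↑Γ : Set (Fin 2 → ℤ)) ∧
        (∃ z ∈ Γ, ∃ z' ∈ Γ, ∃ i, (S : ℤ) ≤ |z i - z' i|) ∧
        ∀ A : Finset (Fin 2 → ℤ), A ⊆ Γ → (∀ z ∈ A,
        ((∃ w ∈ (↑(box 3 L) : Set (Fin 3 → ℤ)),
          BondConfig.relabel (sym2Equiv (Site.shift (-(((2 * L + 1 : ℕ) : ℤ) • (![0, z 0, z 1] : Fin 3 → ℤ))))) (configOfLabels q π.2 (zdGraph 3)) ∈ boxArm (blockR L k + (2 * L + 1)) w) ∧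
        ∀ u ∈ (↑(box 3 (3 * L + 1)) : Set (Fin 3 → ℤ)), ∀ v ∈ (↑(box 3 (3 * L + 1)) : Set (Fin 3 → ℤ)),
          BondConfig.relabel (sym2Equiv (Site.shift (-(((2 * L + 1 : ℕ) : ℤ) • (![0, z 0, z 1] : Fin 3 → ℤ))))) (configOfLabels q π.2 (zdGraph 3)) ∉ twoArm (blockR L k) u v)) →
        StarConn (↑A : Set (Fin 2 → ℤ)) → (∀ z ∈ A, ∀ z' ∈ A, ∀ i, |z i - z' i| ≤ (D : ℤ))))}) hδ0 hδ1 ?_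
  intro T hT
  -- independence within the environment field
  have hE := fun T₁ (hT₁ : T₁ ⊆ T) => vacantReignition_cp_real_biInter_le_pow _ _
    (by
      intro b
      exact vacantReignition_cp_measurableSet_notHarmless _ _ _ _ fun z =>
        vacantReignition_cp_measurable_touched p _ _ _)
    (by
      intro b
      refine vacantReignition_cp_dependsOn_notHarmless _ _ _ _ _ fun z hz => ?_
      exact (vacantReignition_cp_dependsOn_touched p _ _ _).mono
        (vacantReignition_cp_window_mono fun j =>
          vacantReignition_cp_arith hN1 le_rfl (vacantReignition_cp_centre_close S L hz j)))
    hH T₁ (fun a ha b hb hab =>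
      vacantReignition_cp_disjoint_windows S L hS1 (hT a (hT₁ ha) b (hT₁ hb) hab))
  -- independence within the fresh field
  have hF := fun T₁ (hT₁ : T₁ ⊆ T) => vacantReignition_cp_real_biInter_le_pow _ _
    (by
      intro b
      exact vacantReignition_cp_measurableSet_blocked _ _ _ _ _ fun z =>
        measurableSet_setOf.1 (vacantReignition_dom_measurableSet_good q _ L (blockR L k)
          (blockR L k + (2 * L + 1)) (Nat.le_add_right _ _)))
    (by
      intro b
      refine vacantReignition_cp_dependsOn_blocked _ _ _ _ _ _ fun z hz => ?_
      exact (vacantReignition_cp_dependsOn_good q _ L (blockR L k) (blockR L k + (2 * L + 1))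
        (Nat.le_add_right _ _)).mono (vacantReignition_cp_window_mono fun j =>
          vacantReignition_cp_arith hN1 hfit (vacantReignition_cp_centre_close S L hz j)))
    hB T₁ (fun a ha b hb hab =>
      vacantReignition_cp_disjoint_windows S L hS1 (hT a (hT₁ ha) b (hT₁ hb) hab))
  -- the two fields are independent: `(2 η₁)^{#T} = δ^{100 #T}`
  refine (vacantReignition_cp_prod_real_biInter_compl_le (labelMeasure (Fin 3 → ℤ))
    (labelMeasure (Fin 3 → ℤ)) _ _ _ ?_ hη0 T hE hF).trans_eq ?_
  · intro b π hπ
    rw [Set.mem_compl_iff, Set.mem_setOf_eq, not_and_or, not_not] at hπ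
    exact hπ
  · rw [show (2 : ℝ) * (δ ^ 100 / 2) = δ ^ 100 by ring, ← pow_mul]
    norm_num

end Summit.CriticalPhenomena.PercolationContinuityZ3.Theorems

end
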